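import Summits.AtomisticToContinuum.Crystallization.Theorems.ChartedZeroExcessLayeredLatticeLiouvilleZZZYRCXK

/-!
# ChartedZeroExcessLayeredLatticeLiouville · ZZZYRCXL — LEMMAS OF THE θ⁰ SLAB KERNEL (critic r1848 (B): RCXK = program, RCXL = its lemmas)
(decomp-a2c hand-1 g54; target stmt-AtomisticToContinuum-26636 JS-D near reader)

§6 the Option-chain fold rule (invariants of `slabAcc` over chords), §7 strictness of the last codes (`lastCodesStrict` ⇒ pairwise `<` ⇒
`Nodup` far sites), §8 the semantic vocabulary of the hot loop (`dec3`, `piecesFrom`, `vecZ`, `n9Z`, `formZ`, `keyN`, `coefNn`) and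
★ THE WALK INVARIANT `walkP_sound`: a successful walk certifies every piece (`0 < n9 ≤ P9max`, target coordinates in range) and grows the
key-wise sums by exactly `coefR` and `coefNn` at the piece keys; §9 ONE CHORD `addChord_sound` (window `lo < u9 ≤ hi`, the chord vector
`chordE`, `coefRn`, `d18Z`); §10 THE SLAB `chordFold_sound` / ★★ `slabAcc_sound`: `slabAcc … = some T` ⇒ every chord valid and, key-wise,
`Σ_chords chordR ≤ tabR T`, `Σ_chords chordN ≤ tabN T` (the kernel side of lens-2's `KernelSlabSound`; the real-valued reading — `tabR T/2^E ≥
thetaR0` by `div_pow_le_ceilDivNat`, decode to `ChordDatum`, completeness by the count file — is the next file, which needs RCX in the tree).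
Imports RCXK (p860976); 0 sorry.  All `[folklore]`.
-/

namespace Summit.AtomisticToContinuum.Crystallization.Theorems.ChartedZeroExcessLayeredLatticeLiouville.ThetaKernel

/-! ## §6 the Option-chain fold -/

/-- a `foldl` through `Option` that hits `none` stays `none`. [folklore] -/
theorem foldl_optChain_none {α β : Type*} (f : β → α → Option β) (l : List α) :
    l.foldl (fun acc c => match acc with | none => none | some t => f t c) none = none := by
  induction l with
  | nil => rfl
  | cons c rest ih => exact ih

/-- ★ INVARIANT RULE for the Option-chain fold (`slabAcc` over chords): a property preserved by every successful step holds at a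
successful end. [folklore] -/
theorem foldl_optChain_inv {α β : Type*} (f : β → α → Option β) (P : β → Prop)
    (hstep : ∀ b c b', P b → f b c = some b' → P b') :
    ∀ (l : List α) (b b' : β), P b → l.foldl (fun acc c => match acc with | none => none | some t => f t c) (some b) = some b' → P b'
  | [], b, b', hb, h => by simp only [List.foldl_nil, Option.some.injEq] at h; exact h ▸ hb
  | c :: rest, b, b', hb, h => by
    simp only [List.foldl_cons] at h
    cases hc : f b c with
    | none => rw [hc] at h; rw [foldl_optChain_none] at h; exact absurd h (by simp)
    | some b₁ => rw [hc] at h; exact foldl_optChain_inv f P hstep rest b₁ b' (hstep b c b₁ hb hc) h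

/-- membership version: a property of (state, processed-so-far) is not needed for the reader; the STEP LIST form: at a successful end,
every element's step succeeded from some intermediate state satisfying the invariant. [folklore] -/
theorem foldl_optChain_forall {α β : Type*} (f : β → α → Option β) (P : β → Prop) (Q : α → Prop)
    (hstep : ∀ b c b', P b → f b c = some b' → P b' ∧ Q c) :
    ∀ (l : List α) (b b' : β), P b → l.foldl (fun acc c => match acc with | none => none | some t => f t c) (some b) = some b' →
      ∀ c ∈ l, Q c
  | [], _, _, _, _ => by simp
  | c :: rest, b, b', hb, h => by
    simp only [List.foldl_cons] at h
    cases hc : f b c with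
    | none => rw [hc] at h; rw [foldl_optChain_none] at h; exact absurd h (by simp)
    | some b₁ =>
      rw [hc] at h
      intro d hd
      rcases List.mem_cons.mp hd with rfl | hd
      · exact (hstep b _ b₁ hb hc).2
      · exact foldl_optChain_forall f P Q hstep rest b₁ b' (hstep b c b₁ hb hc).1 h d hd

/-! ## §7 strictness of the last codes -/

/-- unfolding `lastCodesStrict` on two or more chords. [folklore] -/
theorem lastCodesStrict_cons_cons (c d : List ℕ) (rest : List (List ℕ)) :
    lastCodesStrict (c :: d :: rest) = (Nat.blt (lastD c 0) (lastD d 0) && lastCodesStrict (d :: rest)) := rfl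

/-- ★ `lastCodesStrict = true` ⇒ the last codes are PAIRWISE strictly increasing (hence the far sites are pairwise distinct). [folklore] -/
theorem pairwise_of_lastCodesStrict : ∀ {cs : List (List ℕ)}, lastCodesStrict cs = true →
    List.Pairwise (fun c d => lastD c 0 < lastD d 0) cs
  | [], _ => List.Pairwise.nil
  | [c], _ => List.pairwise_singleton _ _
  | c :: d :: rest, h => by
    rw [lastCodesStrict_cons_cons, Bool.and_eq_true] at h
    have h1 : lastD c 0 < lastD d 0 := by simpa [Nat.blt_eq] using h.1
    have ih := pairwise_of_lastCodesStrict h.2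
    have ih' := List.pairwise_cons.mp ih
    refine List.pairwise_cons.mpr ⟨fun x hx => ?_, ih⟩
    rcases List.mem_cons.mp hx with rfl | hx
    · exact h1
    · exact lt_trans h1 (ih'.1 x hx)

/-- hence the last codes are `Nodup`. [folklore] -/
theorem nodup_lastCodes_of_strict {cs : List (List ℕ)} (h : lastCodesStrict cs = true) : (cs.map fun c => lastD c 0).Nodup :=
  List.pairwise_map.mpr ((pairwise_of_lastCodesStrict h).imp fun hab => Nat.ne_of_lt hab)

/-! ## §8 semantic vocabulary of the hot loop and the walk invariant -/

/-- the shifted site `(γ₀+600, γ₁+600, m+600)` of a code. -/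
def dec3 (c : ℕ) : ℕ × ℕ × ℕ := (c / 1442401, c / 1201 % 1201, c % 1201)

/-- the pieces walked from site `a` through the codes: consecutive `(from, to)` shifted sites. -/
def piecesFrom : ℕ × ℕ × ℕ → List ℕ → List ((ℕ × ℕ × ℕ) × (ℕ × ℕ × ℕ))
  | _, [] => []
  | a, c :: rest => (a, dec3 c) :: piecesFrom (dec3 c) rest

/-- the SIGNED refined piece vector `(3Δγ₀ + Δreg, 3Δγ₁ + Δreg, Δm)` of a piece (letters by `regN w p` of the shifted layers). -/
def vecZ (w : List ℕ) (p : ℕ) (pr : (ℕ × ℕ × ℕ) × (ℕ × ℕ × ℕ)) : ℤ × ℤ × ℤ :=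
  (3 * ((pr.2.1 : ℤ) - pr.1.1) + ((regN w p pr.2.2.2 : ℤ) - regN w p pr.1.2.2),
    3 * ((pr.2.2.1 : ℤ) - pr.1.2.1) + ((regN w p pr.2.2.2 : ℤ) - regN w p pr.1.2.2), (pr.2.2.2 : ℤ) - pr.1.2.2)

/-- `n9` of a signed refined vector: `v₀² + v₀v₁ + v₁² + 6v₂²`. -/
def n9Z (v : ℤ × ℤ × ℤ) : ℤ := v.1 * v.1 + v.1 * v.2.1 + v.2.1 * v.2.1 + 6 * v.2.2 * v.2.2

/-- a linear form `f₀v₀ + f₁v₁ + g·v₂` (the chord's `d18(e, ·)` when `f = (2e₀+e₁, 2e₁+e₀, 12e₂)`). -/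
def formZ (f0 f1 g : ℤ) (v : ℤ × ℤ × ℤ) : ℤ := f0 * v.1 + f1 * v.2.1 + g * v.2.2

/-- the piece key code computed by the hot loop. -/
def keyN (p : ℕ) (pr : (ℕ × ℕ × ℕ) × (ℕ × ℕ × ℕ)) : ℕ :=
  ((((pr.1.2.2 + 12) % p) * 1201 + (pr.2.1 + 600 - pr.1.1)) * 1201 + (pr.2.2.1 + 600 - pr.1.2.1)) * 1201 + (pr.2.2.2 + 600 - pr.1.2.2)

/-- the ℕ `coefN` expression of the hot loop: `⌈An·(U4n·p9 − da²)/(Bn·p9)⌉`. -/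
def coefNn (An Bn U4n p9 da : ℕ) : ℕ := (An * (U4n * p9 - da * da) + Bn * p9 - 1) / (Bn * p9)

section Walk

variable (w : List ℕ) (p P9 f0p f0n f1p f1n gp gn Cp Cn An Bn U4n cR : ℕ)

/-- unfolding the walk on no code. [folklore] -/
theorem walkP_nil (a0 a1 am : ℕ) (t : PT) : walkP w p P9 f0p f0n f1p f1n gp gn Cp Cn An Bn U4n cR a0 a1 am [] t = some t := rfl

/-- unfolding the walk on a code (the hot loop body, `let`s inlined). [folklore] -/
theorem walkP_cons (a0 a1 am c : ℕ) (rest : List ℕ) (t : PT) :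
    walkP w p P9 f0p f0n f1p f1n gp gn Cp Cn An Bn U4n cR a0 a1 am (c :: rest) t =
      (let b0 := c / 1442401
      let b1 := c / 1201 % 1201
      let bm := c % 1201
      let ra := regN w p am
      let rb := regN w p bm
      let x0 := 3 * (b0 + 1201 - a0) + rb - ra
      let x1 := 3 * (b1 + 1201 - a1) + rb - ra
      let xm := bm + 1201 - am
      let p9n := x0 * x0 + x0 * x1 + x1 * x1 + 38944827 + 6 * (xm * xm) + 8654406 - (10809 * (x0 + x1) + 14412 * xm)
      bif (!(Nat.blt c 1732323601) || Nat.beq p9n 0 || Nat.blt P9 p9n) then none else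
      let P := f0p * x0 + f1p * x1 + gp * xm + Cn
      let Q := f0n * x0 + f1n * x1 + gn * xm + Cp
      let da := (P - Q) + (Q - P)
      let den := Bn * p9n
      let cN := (An * (U4n * p9n - da * da) + den - 1) / den
      match t.bump (((((am + 12) % p) * 1201 + (b0 + 600 - a0)) * 1201 + (b1 + 600 - a1)) * 1201 + (bm + 600 - am)) cR cN with
      | none => none
      | some t' => walkP w p P9 f0p f0n f1p f1n gp gn Cp Cn An Bn U4n cR b0 b1 bm rest t') := rfl

end Walk

section WalkSound

/-- the Boolean guard of the hot loop, read back: code in range, `0 < p9 ≤ P9max`. [folklore] -/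
theorem guard_false {c p9n P9 : ℕ} (hg : (!(Nat.blt c 1732323601) || Nat.beq p9n 0 || Nat.blt P9 p9n) = false) :
    c < 1732323601 ∧ 0 < p9n ∧ p9n ≤ P9 := by
  rcases Bool.or_eq_false_iff.mp hg with ⟨h12, h3⟩
  rcases Bool.or_eq_false_iff.mp h12 with ⟨h1, h2⟩
  simp only [Bool.not_eq_false', Nat.blt_eq] at h1
  have h2' : p9n ≠ 0 := fun h0 => by subst h0; exact Bool.false_ne_true (h2.symm.trans (Nat.beq_refl 0))
  have h3' : ¬ P9 < p9n := fun hlt => by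
    have : Nat.blt P9 p9n = true := by simpa [Nat.blt_eq] using hlt
    rw [h3] at this; exact Bool.false_ne_true this
  omega

/-- the pieces from `a` through `c :: rest`. [folklore] -/
theorem piecesFrom_cons (a : ℕ × ℕ × ℕ) (c : ℕ) (rest : List ℕ) :
    piecesFrom a (c :: rest) = (a, dec3 c) :: piecesFrom (dec3 c) rest := rfl

/-- no code, no piece. [folklore] -/
theorem piecesFrom_nil (a : ℕ × ℕ × ℕ) : piecesFrom a [] = [] := rfl

/-- the components of a decoded in-range code are shifted coordinates `< 1201`. [folklore] -/
theorem dec3_lt {c : ℕ} (hc : c < 1732323601) : c / 1442401 < 1201 ∧ c / 1201 % 1201 < 1201 ∧ c % 1201 < 1201 := by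
  refine ⟨?_, Nat.mod_lt _ (by norm_num), Nat.mod_lt _ (by norm_num)⟩
  exact Nat.div_lt_of_lt_mul (by norm_num; exact hc)

/-- ★★ THE WALK INVARIANT.  A successful walk from an in-range site `(a0, a1, am)` with the sign-split constants of the linear form
`(f0, f1, g)` certifies: every piece lands in range with `0 < n9 ≤ P9max`, and the key-wise sums of the payload tree grow by exactly `cR`
(R column) and `coefNn An Bn U4n n9 |form|` (N column) at the piece keys. [folklore] -/
theorem walkP_sound (w : List ℕ) (p P9 : ℕ) (hw : ∀ x, regN w p x ≤ 2) (f0 f1 g : ℤ) (An Bn U4n cR : ℕ) :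
    ∀ (cs : List ℕ) (a0 a1 am : ℕ) (t t' : PT), a0 < 1201 → a1 < 1201 → am < 1201 →
    walkP w p P9 f0.toNat (-f0).toNat f1.toNat (-f1).toNat g.toNat (-g).toNat
        (3603 * (f0 + f1) + 1201 * g).toNat (-(3603 * (f0 + f1) + 1201 * g)).toNat An Bn U4n cR a0 a1 am cs t = some t' →
    (∀ pr ∈ piecesFrom (a0, a1, am) cs,
        pr.2.1 < 1201 ∧ pr.2.2.1 < 1201 ∧ pr.2.2.2 < 1201 ∧ 0 < n9Z (vecZ w p pr) ∧ n9Z (vecZ w p pr) ≤ P9) ∧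
    (∀ q, tabR t'.toList q = tabR t.toList q +
        (((piecesFrom (a0, a1, am) cs).filter fun pr => keyN p pr = q).map fun _ => cR).sum) ∧
    (∀ q, tabN t'.toList q = tabN t.toList q +
        (((piecesFrom (a0, a1, am) cs).filter fun pr => keyN p pr = q).map fun pr =>
          coefNn An Bn U4n (n9Z (vecZ w p pr)).toNat (formZ f0 f1 g (vecZ w p pr)).natAbs).sum)
  | [], a0, a1, am, t, t', _, _, _, h => by
    rw [walkP_nil, Option.some.injEq] at h
    subst h
    simp [piecesFrom_nil]
  | c :: rest, a0, a1, am, t, t', ha0, ha1, ham, h => by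
    rw [walkP_cons] at h
    extract_lets b0 b1 bm ra rb x0 x1 xm p9n P Q da den cN at h
    cases hg : (!(Nat.blt c 1732323601) || Nat.beq p9n 0 || Nat.blt P9 p9n) with
    | true => rw [hg] at h; exact absurd h (by simp)
    | false =>
      rw [hg] at h
      simp only [cond_false] at h
      cases hb : t.bump (((((am + 12) % p) * 1201 + (b0 + 600 - a0)) * 1201 + (b1 + 600 - a1)) * 1201 + (bm + 600 - am)) cR cN with
      | none => rw [hb] at h; exact absurd h (by simp)
      | some t₁ =>
        rw [hb] at h
        simp only at h
        obtain ⟨hc, hp0, hpP⟩ := guard_false hg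
        obtain ⟨hb0, hb1, hbm⟩ := dec3_lt hc
        -- the induction hypothesis from the landing site
        obtain ⟨IH1, IH2, IH3⟩ := walkP_sound w p P9 hw f0 f1 g An Bn U4n cR rest b0 b1 bm t₁ t' hb0 hb1 hbm h
        -- the offset identities at this piece
        have h0 : (x0 : ℤ) = (3 * ((b0 : ℤ) - a0) + ((rb : ℤ) - ra)) + 3603 := offset_coord a0 b0 ra rb ha0 (hw am)
        have h1 : (x1 : ℤ) = (3 * ((b1 : ℤ) - a1) + ((rb : ℤ) - ra)) + 3603 := offset_coord a1 b1 ra rb ha1 (hw am)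
        have hm : (xm : ℤ) = ((bm : ℤ) - am) + 1201 := offset_layer am bm ham
        have e9 : (p9n : ℤ) = n9Z (vecZ w p ((a0, a1, am), (b0, b1, bm))) := by
          rw [offset_n9 x0 x1 xm _ _ _ h0 h1 hm]; simp only [n9Z, vecZ]; rfl
        have e9n : (n9Z (vecZ w p ((a0, a1, am), (b0, b1, bm)))).toNat = p9n := by rw [← e9]; simp
        have eform : ((P : ℤ) - Q) = formZ f0 f1 g (vecZ w p ((a0, a1, am), (b0, b1, bm))) := by
          have := offset_form f0 f1 g (3603 * (f0 + f1) + 1201 * g) x0 x1 xm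
          rw [this, h0, h1, hm]; simp only [formZ, vecZ]; ring
        have eda : da = (formZ f0 f1 g (vecZ w p ((a0, a1, am), (b0, b1, bm)))).natAbs := by
          have h := offset_absdiff P Q
          rw [eform] at h
          rw [← Int.natCast_natAbs] at h
          exact_mod_cast h
        have ekey : keyN p ((a0, a1, am), (b0, b1, bm)) =
            (((((am + 12) % p) * 1201 + (b0 + 600 - a0)) * 1201 + (b1 + 600 - a1)) * 1201 + (bm + 600 - am)) := rfl
        have hdec : dec3 c = (b0, b1, bm) := rfl
        refine ⟨?_, ?_, ?_⟩
        · intro pr hpr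
          rw [piecesFrom_cons, hdec, List.mem_cons] at hpr
          rcases hpr with rfl | hpr
          · refine ⟨hb0, hb1, hbm, ?_, ?_⟩
            · rw [← e9]; exact_mod_cast hp0
            · rw [← e9]; exact_mod_cast hpP
          · exact IH1 pr hpr
        · intro q
          rw [IH2 q, tabR_bump hb q, piecesFrom_cons, hdec, List.filter_cons]
          by_cases hq : keyN p ((a0, a1, am), (b0, b1, bm)) = q
          · have hq' := hq
            rw [ekey] at hq'
            simp [hq, hq']; ring
          · have hq' : ¬ ((((((am + 12) % p) * 1201 + (b0 + 600 - a0)) * 1201 + (b1 + 600 - a1)) * 1201 + (bm + 600 - am)) = q) := by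
              rwa [ekey] at hq
            simp [hq, hq']
        · intro q
          rw [IH3 q, tabN_bump hb q, piecesFrom_cons, hdec, List.filter_cons]
          by_cases hq : keyN p ((a0, a1, am), (b0, b1, bm)) = q
          · have hq' := hq
            rw [ekey] at hq'
            simp only [hq', if_true, hq, decide_true, List.map_cons, List.sum_cons]
            rw [e9n, ← eda]
            simp only [coefNn]
            ring
          · have hq' : ¬ ((((((am + 12) % p) * 1201 + (b0 + 600 - a0)) * 1201 + (b1 + 600 - a1)) * 1201 + (bm + 600 - am)) = q) := by
              rwa [ekey] at hq
            simp [hq, hq']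

end WalkSound

/-! ## §9 one chord -/

/-- the shifted base site `X = (0, 0, mX)`. -/
def chordX (mX : ℕ) : ℕ × ℕ × ℕ := (600, 600, 600 + mX)

/-- the signed refined CHORD vector `e = Y − X` read off the codes (Y = the last code). -/
def chordE (w : List ℕ) (p mX : ℕ) (c : List ℕ) : ℤ × ℤ × ℤ := vecZ w p (chordX mX, dec3 (lastD c 0))

/-- the chord's `d18(e, ·)` as a linear form: `f = (2e₀+e₁, 2e₁+e₀, 12e₂)`. -/
def d18Z (e v : ℤ × ℤ × ℤ) : ℤ := formZ (2 * e.1 + e.2.1) (2 * e.2.1 + e.1) (12 * e.2.2) v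

/-- `d18Z` is lens-2's `d18` polynomial `2e₀v₀ + 2e₁v₁ + e₀v₁ + e₁v₀ + 12e₂v₂`. [folklore] -/
theorem d18Z_eq (e v : ℤ × ℤ × ℤ) :
    d18Z e v = 2 * e.1 * v.1 + 2 * e.2.1 * v.2.1 + e.1 * v.2.1 + e.2.1 * v.1 + 12 * e.2.2 * v.2.2 := by
  simp only [d18Z, formZ]; ring

/-- the ℕ `coefR` expression of `addChord`: `⌈An/u9⁴⌉` with `u9⁴ = (u9·u9)·(u9·u9)`. -/
def coefRn (An u9n : ℕ) : ℕ := (An + u9n * u9n * (u9n * u9n) - 1) / (u9n * u9n * (u9n * u9n))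

/-- the window guard of `addChord`, read back. [folklore] -/
theorem window_false {u9 lo hi : ℤ} (hg : ((u9 ≤ lo : Bool) || (hi < u9 : Bool)) = false) : lo < u9 ∧ u9 ≤ hi := by
  rcases Bool.or_eq_false_iff.mp hg with ⟨h1, h2⟩
  rw [decide_eq_false_iff_not] at h1 h2
  constructor <;> omega

/-- ★ ONE CHORD: a successful `addChord` certifies the window `lo < u9 ≤ hi` of the chord, every piece of its path (in range,
`0 < n9 ≤ P9max`), and grows the key-wise sums by exactly `coefRn (AE·n) u9` and `coefNn (AE·n) (4u9⁵) (4u9) p9 |d18|` at the piece keys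
(`n = #codes = #pieces`). [folklore] -/
theorem addChord_sound (w : List ℕ) (p P9 AE mX : ℕ) (hw : ∀ x, regN w p x ≤ 2) (hmX : mX < 601) (lo hi : ℤ) (c : List ℕ)
    (t t' : PT) (h : addChord w p P9 AE mX lo hi c t = some t') :
    lo < n9Z (chordE w p mX c) ∧ n9Z (chordE w p mX c) ≤ hi ∧
    (∀ pr ∈ piecesFrom (chordX mX) c,
        pr.2.1 < 1201 ∧ pr.2.2.1 < 1201 ∧ pr.2.2.2 < 1201 ∧ 0 < n9Z (vecZ w p pr) ∧ n9Z (vecZ w p pr) ≤ P9) ∧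
    (∀ q, tabR t'.toList q = tabR t.toList q +
        (((piecesFrom (chordX mX) c).filter fun pr => keyN p pr = q).map fun _ =>
          coefRn (AE * c.length) (n9Z (chordE w p mX c)).toNat).sum) ∧
    (∀ q, tabN t'.toList q = tabN t.toList q +
        (((piecesFrom (chordX mX) c).filter fun pr => keyN p pr = q).map fun pr =>
          coefNn (AE * c.length) (4 * ((n9Z (chordE w p mX c)).toNat * (n9Z (chordE w p mX c)).toNat *
              ((n9Z (chordE w p mX c)).toNat * (n9Z (chordE w p mX c)).toNat)) * (n9Z (chordE w p mX c)).toNat)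
            (4 * (n9Z (chordE w p mX c)).toNat)
            (n9Z (vecZ w p pr)).toNat (d18Z (chordE w p mX c) (vecZ w p pr)).natAbs).sum) := by
  unfold addChord at h
  extract_lets y y0 y1 ym dr e0 e1 em u9 u9n An u2 u4 cR f0 f1 g C at h
  cases hg : ((u9 ≤ lo : Bool) || (hi < u9 : Bool)) with
  | true => rw [hg] at h; exact absurd h (by simp)
  | false =>
    rw [hg] at h
    simp only [cond_false] at h
    obtain ⟨hlo, hhi⟩ := window_false hg
    have hdr : dr = (regN w p ym : ℤ) - regN w p (mX + 600) := rfl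
    have he0 : e0 = 3 * ((y0 : ℤ) - 600) + dr := rfl
    have he1 : e1 = 3 * ((y1 : ℤ) - 600) + dr := rfl
    have hem : em = (ym : ℤ) - 600 - mX := rfl
    have hu9' : u9 = e0 * e0 + e0 * e1 + e1 * e1 + 6 * em * em := rfl
    have hE : chordE w p mX c = (e0, e1, em) := by
      show vecZ w p ((600, 600, 600 + mX), (y0, y1, ym)) = (e0, e1, em)
      rw [he0, he1, hem, hdr, Nat.add_comm mX 600]
      simp only [vecZ]
      push_cast
      refine Prod.ext ?_ (Prod.ext ?_ ?_)
      · simp only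
      · simp only
      · simp only; ring
    have hu9 : n9Z (chordE w p mX c) = u9 := by rw [hE, hu9']; simp only [n9Z]
    have ham : 600 + mX < 1201 := by omega
    obtain ⟨W1, W2, W3⟩ := walkP_sound w p P9 hw f0 f1 g An (4 * u4 * u9n) (4 * u9n) cR c 600 600 (600 + mX) t t'
      (by norm_num) (by norm_num) ham h
    refine ⟨hu9 ▸ hlo, hu9 ▸ hhi, W1, fun q => ?_, fun q => ?_⟩
    · rw [W2 q, hu9]; rfl
    · rw [W3 q, hu9]
      congr 2
      refine List.map_congr_left fun pr _ => ?_
      rw [hE]; rfl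

/-! ## §10 the slab fold -/

/-- the R contribution of one chord at key `q`: `coefRn` once per piece with that key. -/
def chordR (w : List ℕ) (p AE mX : ℕ) (c : List ℕ) (q : ℕ) : ℕ :=
  (((piecesFrom (chordX mX) c).filter fun pr => keyN p pr = q).map fun _ =>
    coefRn (AE * c.length) (n9Z (chordE w p mX c)).toNat).sum

/-- the N contribution of one chord at key `q`: `coefNn` per piece with that key. -/
def chordN (w : List ℕ) (p AE mX : ℕ) (c : List ℕ) (q : ℕ) : ℕ :=
  (((piecesFrom (chordX mX) c).filter fun pr => keyN p pr = q).map fun pr =>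
    coefNn (AE * c.length) (4 * ((n9Z (chordE w p mX c)).toNat * (n9Z (chordE w p mX c)).toNat *
        ((n9Z (chordE w p mX c)).toNat * (n9Z (chordE w p mX c)).toNat)) * (n9Z (chordE w p mX c)).toNat)
      (4 * (n9Z (chordE w p mX c)).toNat) (n9Z (vecZ w p pr)).toNat (d18Z (chordE w p mX c) (vecZ w p pr)).natAbs).sum

/-- ★ THE CHORD FOLD: a successful fold of `addChord` over the chords certifies every chord and adds up the contributions key-wise.
[folklore] -/
theorem chordFold_sound (w : List ℕ) (p P9 AE mX : ℕ) (hw : ∀ x, regN w p x ≤ 2) (hmX : mX < 601) (lo hi : ℤ) :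
    ∀ (cs : List (List ℕ)) (t t' : PT),
    cs.foldl (fun acc c => match acc with | none => none | some t => addChord w p P9 AE mX lo hi c t) (some t) = some t' →
    (∀ c ∈ cs, (lo < n9Z (chordE w p mX c) ∧ n9Z (chordE w p mX c) ≤ hi ∧
      ∀ pr ∈ piecesFrom (chordX mX) c,
        pr.2.1 < 1201 ∧ pr.2.2.1 < 1201 ∧ pr.2.2.2 < 1201 ∧ 0 < n9Z (vecZ w p pr) ∧ n9Z (vecZ w p pr) ≤ P9)) ∧
    (∀ q, tabR t'.toList q = tabR t.toList q + (cs.map fun c => chordR w p AE mX c q).sum) ∧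
    (∀ q, tabN t'.toList q = tabN t.toList q + (cs.map fun c => chordN w p AE mX c q).sum)
  | [], t, t', h => by
    simp only [List.foldl_nil, Option.some.injEq] at h
    subst h; simp
  | c :: rest, t, t', h => by
    simp only [List.foldl_cons] at h
    have hnone : ∀ l : List (List ℕ),
        l.foldl (fun acc c => match acc with | none => none | some t => addChord w p P9 AE mX lo hi c t) none = none :=
      fun l => by
        induction l with
        | nil => rfl
        | cons _ _ ih => exact ih
    cases hc : addChord w p P9 AE mX lo hi c t with
    | none => rw [hc, hnone] at h; exact absurd h (by simp)
    | some t₁ =>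
      rw [hc] at h
      obtain ⟨A1, A2, A3, A4, A5⟩ := addChord_sound w p P9 AE mX hw hmX lo hi c t t₁ hc
      obtain ⟨IH1, IH2, IH3⟩ := chordFold_sound w p P9 AE mX hw hmX lo hi rest t₁ t' h
      refine ⟨fun d hd => ?_, fun q => ?_, fun q => ?_⟩
      · rcases List.mem_cons.mp hd with rfl | hd
        · exact ⟨A1, A2, A3⟩
        · exact IH1 d hd
      · rw [IH2 q, A4 q, List.map_cons, List.sum_cons, chordR]; ring
      · rw [IH3 q, A5 q, List.map_cons, List.sum_cons, chordN]; ring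

/-- ★★ THE SLAB PROGRAM IS SOUND (kernel side): `slabAcc w P9max E mX lo hi t0 chords = some T` ⇒ every chord's window and pieces are
valid, and for every key code `q` the table's key-wise sums DOMINATE the summed dyadic coefficients of all incidences with that key
(equality up to the initial payloads of `t0`, which are naturals). [folklore] -/
theorem slabAcc_sound (w : List ℕ) (P9 E mX : ℕ) (hw : ∀ x, regN w w.length x ≤ 2) (hmX : mX < 601) (lo hi : ℤ) (t0 : PT)
    (cs : List (List ℕ)) (T : List (ℕ × ℕ × ℕ)) (h : slabAcc w P9 E mX lo hi t0 cs = some T) :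
    (∀ c ∈ cs, (lo < n9Z (chordE w w.length mX c) ∧ n9Z (chordE w w.length mX c) ≤ hi ∧
      ∀ pr ∈ piecesFrom (chordX mX) c,
        pr.2.1 < 1201 ∧ pr.2.2.1 < 1201 ∧ pr.2.2.2 < 1201 ∧ 0 < n9Z (vecZ w w.length pr) ∧ n9Z (vecZ w w.length pr) ≤ P9)) ∧
    (∀ q, (cs.map fun c => chordR w w.length (2 ^ E * 45927) mX c q).sum ≤ tabR T q) ∧
    (∀ q, (cs.map fun c => chordN w w.length (2 ^ E * 45927) mX c q).sum ≤ tabN T q) := by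
  unfold slabAcc at h
  simp only [Option.map_eq_some_iff] at h
  obtain ⟨t', ht', hT⟩ := h
  obtain ⟨H1, H2, H3⟩ := chordFold_sound w w.length P9 (2 ^ E * 45927) mX hw hmX lo hi cs t0 t' ht'
  refine ⟨H1, fun q => ?_, fun q => ?_⟩
  · rw [← hT, H2 q]; exact Nat.le_add_left _ _
  · rw [← hT, H3 q]; exact Nat.le_add_left _ _

end Summit.AtomisticToContinuum.Crystallization.Theorems.ChartedZeroExcessLayeredLatticeLiouville.ThetaKernel
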